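import Literature.MathematicalPhysics.QuantumFieldTheory.YangMillsEuclidean
import Literature.MathematicalPhysics.QuantumLattice.GaugeGroupsProofs
import HarnessLib

/-!
# Clay Yang–Mills (Euclidean reading): discharge of the two sanity implications

Sibling proof file of `Literature/MathematicalPhysics/QuantumFieldTheory/YangMillsEuclidean.lean`.
That file vendors three OPEN PROBLEMS as `def … : Prop` (acceptance-suite targets
**constructive-qft.S01/S03**): `ClayYangMillsEuclidean`, `ClayYangMillsEuclideanGap`,
`ClayYangMillsEuclideanAlong` — renderings of the Clay Millennium problem
"Yang–Mills Existence and Mass Gap. *Prove that for any compact simple gauge group `G`, a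
non-trivial quantum Yang–Mills theory exists on `ℝ⁴` and has a mass gap `Δ > 0`.*"
(Jaffe–Witten, *Quantum Yang–Mills theory*, §4 "The Problem", p. 6; clustering as a consequence
of the gap: §5, p. 6). These are conjectures (CONVENTIONS §4) and have no `_holds`; nothing here
asserts them.

What IS proved here are the two named facts of that file which are honest theorems — the
sanity implications whose interim proofs were demoted to facts by the M5 import only because they
used the then-sorried prelude result `isSimpleCompactGroup_specialUnitaryGroup`, now discharged in
`Literature/MathematicalPhysics/QuantumLattice/GaugeGroupsProofs.lean`
(`isSimpleCompactGroup_specialUnitaryGroup_holds`):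

* `clayYangMillsEuclideanGap_su3_imp_holds`: the general-`G` mass-gap form
  `ClayYangMillsEuclideanGap`, specialised to `G = SU(3)` with its fundamental representation
  (simple, faithful, unitary), yields `ClayYangMillsEuclidean` minus the area law, with
  exponential clustering in its place;
* `ClayYangMillsEuclideanGap.exists_hasExponentialClustering_specialUnitaryGroup_holds`: for
  `SU(n)`, `n ≥ 2`, `ClayYangMillsEuclideanGap` yields an OS measure on `𝒮'(ℝ⁴)`, continuum
  limit of lattice `SU(n)` Yang–Mills, with exponential clustering at some rate `m`.

Both proofs are the preserved interim proofs with `isSimpleCompactGroup_specialUnitaryGroup`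
replaced by its discharge. No statement is introduced or changed; no new fact is minted.
The `SecondCountableTopology (SU(n))` instance synthesised inside `ClayYangMillsEuclideanGap`
(from faithfulness of `ρ`) and the file's `instSecondCountableTopologySpecialUnitaryGroup` enter
`plaquetteObservable` only through its `Prop`-valued `measurable` field, so the two
`LocalGaugeObservable`s agree definitionally (proof irrelevance).
-/

open MeasureTheory Filter Topology
open Literature.MathematicalPhysics.QuantumLattice

namespace Literature.MathematicalPhysics.QuantumFieldTheory

/-- **Discharge of `clayYangMillsEuclideanGap_su3_imp`.** If the Euclidean Clay Yang–Mills
mass-gap statement `ClayYangMillsEuclideanGap` holds for every compact simple `G`, then at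
`G = SU(3)` (simple: `isSimpleCompactGroup_specialUnitaryGroup_holds`; fundamental representation
continuous, faithful and unitary: `continuous_fundamentalRep`, `fundamentalRep_injective`,
`fundamentalRep_mem_unitaryGroup`) one obtains a scaling scheme and an OS measure `μ` on `𝒮'(ℝ⁴)`,
continuum limit in law of the smeared plaquette fields of `SU(3)` lattice Yang–Mills, non-Gaussian,
with exponential clustering for some `m > 0` — i.e. `ClayYangMillsEuclidean` with the area law
replaced by clustering (Jaffe–Witten §4, p. 6: the problem is posed "for any compact simple gauge
group `G`", of which `SU(3)` is the physical instance, §1). [cite: JaffeWitten2000, §4 (p. 6)] -/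
theorem clayYangMillsEuclideanGap_su3_imp_holds : clayYangMillsEuclideanGap_su3_imp := fun h =>
  h (Matrix.specialUnitaryGroup (Fin 3) ℂ) 3 (fundamentalRep (Fin 3))
    (isSimpleCompactGroup_specialUnitaryGroup_holds (by simp)) (continuous_fundamentalRep (Fin 3))
    (fundamentalRep_injective (Fin 3)) fundamentalRep_mem_unitaryGroup

/-- **Discharge of `ClayYangMillsEuclideanGap.exists_hasExponentialClustering_specialUnitaryGroup`.**
For `SU(n)`, `n ≥ 2` (simple by `isSimpleCompactGroup_specialUnitaryGroup_holds`), the statement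
`ClayYangMillsEuclideanGap` produces a scaling scheme, an OS measure `μ` on `𝒮'(ℝ⁴)` which is the
continuum limit in law of the smeared plaquette fields of lattice `SU(n)` Yang–Mills, and a rate
`m` with `HasExponentialClustering 4 μ m` (the clustering consequence of a mass gap, Jaffe–Witten
§5, p. 6; Glimm–Jaffe (1987) §6.1, §19.7 for the OS-measure form). [cite: JaffeWitten2000, §§4–5 (p. 6)] -/
theorem ClayYangMillsEuclideanGap.exists_hasExponentialClustering_specialUnitaryGroup_holds :
    ClayYangMillsEuclideanGap.exists_hasExponentialClustering_specialUnitaryGroup := by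
  intro h n hn
  obtain ⟨sch, μ, hlim, hOS, -, m, -, hm⟩ := h (Matrix.specialUnitaryGroup (Fin n) ℂ) n
    (fundamentalRep (Fin n)) (isSimpleCompactGroup_specialUnitaryGroup_holds (by simpa using hn))
    (continuous_fundamentalRep (Fin n)) (fundamentalRep_injective (Fin n))
    fundamentalRep_mem_unitaryGroup
  exact ⟨sch, μ, m, hlim, hOS, hm⟩

end Literature.MathematicalPhysics.QuantumFieldTheory
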